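import Summits.ResolutionOfSingularities.ResolutionOfSingularities.Theorems.PurelyInseparableDim4ResConeLossFreeTail
import Summits.ResolutionOfSingularities.ResolutionOfSingularities.Theorems.PurelyInseparableDim4ResConeLightSlices
import HarnessLib
import HarnessLib.Audit.Tags

/-!
# Purely inseparable four-folds — K2(p) AS «NO LIGHT POWER-CONE TRAP ∧ NO LOSSY BINARY-CONE TRAP»
# (K2(p) lane: the BOARD PACKAGING of slice C after (C13) `no_lossfree_tail`, on top of the slice-B packaging
# `…LightSlices.noAboveFloorTrap_iff_lightSlices` (res-dim4-p-2 g3 / res-dim4-p-1 g3); file-holder res-dim4-p-5 g3)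

[OURS · counted 0 · cell `res-dim4-pi` · K2(p) lane (desk WORDS #78 (d), #80 (d), #96 (b), #105 (d)) · seat p-5 g3.]
Nothing here proves K2(p) = `RidgeBudget.NoAboveFloorTrap p p`, K2(5), `NoIsolatedTrap p p` or resolution of
singularities in dimension ≥ 4 / characteristic `p`.  AI kernel work, weaker than expert review.

A binary-cone (slice C) chain is LOSSY AT STEP `k` when it translates a boundary letter: `∃ i ≠ j k, b k i ≠ 0 ∧
1 ≤ (c k).r i`.
* `sliceC_iff_noLossyTrap` — over each field: «no binary-cone trap» ⟺ «no binary-cone trap with witnesses that is lossy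
  infinitely often» (`…LossFreeTail.no_lossfree_tail` excludes the eventually loss-free ones; witnesses by
  `FreeTail.exists_witnesses`);
* **`noAboveFloorTrap_iff_lightSliceB_and_lossySliceC`** — THE LOCATED RESIDUE OF RECORD after slice C's C2–C13:
  «K2(p) ⟺ no LIGHT power-cone trap (e_G ≡ 3, light satellite steps recurring) ∧ no LOSSY binary-cone trap (e_G ≡ 2,
  boundary letters translated infinitely often)», every prime, unconditionally in the kernel;
* `noAboveFloorTrap_five_iff_lightSliceB_and_lossySliceC` — the same at `p = 5` with «light» read as orders `(6, 6)`.
Both regimes remain OPEN.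
[cite: CossartJannsenSaito2020, Thm. 3.14, Lemma 13.2, Thm. 13.7]
bears_on: LADDER-RESOLUTION:D157-DOOR2 (res-dim4-pi · K2(p) = `RidgeBudget.NoAboveFloorTrap p p` · slices B/C packaging).
Supports stmt-ResolutionOfSingularities-16155 (helper).
-/

set_option linter.dupNamespace false -- mandated namespace of this single-conjunct summit

noncomputable section

namespace Summit.ResolutionOfSingularities.ResolutionOfSingularities.Theorems.PIDim4

namespace ResCone

open MvPolynomial
open Literature.AlgebraicGeometry.Resolution
open Literature.AlgebraicGeometry.Resolution.CentreBlowup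
open Literature.AlgebraicGeometry.Resolution.Hauser2010
open Literature.AlgebraicGeometry.Resolution.HauserPerlega2019
open RidgeBudget (NoAboveFloorTrap)

/-- **«No binary-cone trap» ⟺ «no LOSSY binary-cone trap»** over a field of characteristic `p`: a binary-cone chain
that translates boundary letters only finitely often is eventually loss-free, excluded by `no_lossfree_tail`. [OURS]
[cite: CossartJannsenSaito2020, Thm. 3.14, Lemma 13.2, Thm. 13.7] -/
theorem sliceC_iff_noLossyTrap (p : ℕ) [Fact p.Prime] (K : Type) [Field K] [CharP K p] [DecidableEq K] :
    (¬ ∃ (c : ℕ → State K) (d : ℕ), 2 ≤ d ∧ d < p ∧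
        (∀ e' ∈ (c 0).F.support, (c 0).r ≤ e') ∧
        ∀ k, IsIsolated p (c k).F ∧ Step0 p (c k) (c (k + 1)) ∧ ordZero (c k).F ≠ p ∧
          (c k).shade = (d : ℕ∞) ∧ Module.finrank K (resVertex (c k)) = 2) ↔
    (¬ ∃ (c : ℕ → State K) (d : ℕ) (j : ℕ → Fin 4) (b : ℕ → Fin 4 → K), 2 ≤ d ∧ d < p ∧
        (∀ e' ∈ (c 0).F.support, (c 0).r ≤ e') ∧ FreeTail.IsWitnessedChain p c j b ∧
        (∀ k, IsIsolated p (c k).F ∧ Step0 p (c k) (c (k + 1)) ∧ ordZero (c k).F ≠ p ∧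
          (c k).shade = (d : ℕ∞) ∧ Module.finrank K (resVertex (c k)) = 2) ∧
        ∀ N, ∃ k, N ≤ k ∧ ∃ i, i ≠ j k ∧ b k i ≠ 0 ∧ 1 ≤ (c k).r i) := by
  constructor
  · rintro h ⟨c, d, -, -, h2d, hdp, hr0, -, hall, -⟩
    exact h ⟨c, d, h2d, hdp, hr0, hall⟩
  · rintro h ⟨c, d, h2d, hdp, hr0, hall⟩
    obtain ⟨j, b, hw⟩ := FreeTail.exists_witnesses (fun k => (hall k).2.1)
    have hc : ∀ k, IsIsolated p (c k).F ∧ Step0 p (c k) (c (k + 1)) := fun k => ⟨(hall k).1, (hall k).2.1⟩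
    -- not lossy infinitely often: loss-free from some `N` on
    have hfin : ∃ N, ∀ k, N ≤ k → ∀ i, b k i ≠ 0 → (c k).r i = 0 := by
      by_contra hne
      push Not at hne
      refine h ⟨c, d, j, b, h2d, hdp, hr0, hw, hall, fun N => ?_⟩
      obtain ⟨k, hNk, i, hbi, hri⟩ := hne N
      refine ⟨k, hNk, i, fun hij => ?_, hbi, Nat.one_le_iff_ne_zero.mpr hri⟩
      rw [hij] at hbi
      exact hbi (hw k).2.1
    obtain ⟨N, hloss⟩ := hfin
    exact no_lossfree_tail p hc hw hr0 (fun k => (hall k).2.2.1) hdp (fun k _ => (hall k).2.2.2.1)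
      (fun k _ => (hall k).2.2.2.2) hloss

/-- **THE LOCATED RESIDUE OF RECORD: K2(p) ⟺ no LIGHT power-cone trap ∧ no LOSSY binary-cone trap**, every prime `p`,
unconditionally in the kernel: an infinite isolated above-floor constant-shade chain with `x^{r₀} ∣ F₀` is either a
power cone (`e_G ≡ 3`) returning for ever to light satellite steps, or a binary cone (`e_G ≡ 2`) translating boundary
letters for ever.  Both remain OPEN. [OURS] [cite: CossartJannsenSaito2020, Thm. 3.14, Lemma 13.2, Thm. 13.7] -/
theorem noAboveFloorTrap_iff_lightSliceB_and_lossySliceC (p : ℕ) [Fact p.Prime] :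
    NoAboveFloorTrap p p ↔ ∀ (K : Type) [Field K] [CharP K p] [DecidableEq K],
      (¬ ∃ (c : ℕ → State K) (d : ℕ) (j : ℕ → Fin 4) (b : ℕ → Fin 4 → K), 2 ≤ d ∧ d < p ∧
          (∀ e' ∈ (c 0).F.support, (c 0).r ≤ e') ∧ FreeTail.IsWitnessedChain p c j b ∧
          (∀ k, IsIsolated p (c k).F ∧ Step0 p (c k) (c (k + 1)) ∧ ordZero (c k).F ≠ p ∧
            (c k).shade = (d : ℕ∞) ∧ Module.finrank K (resVertex (c k)) = 3) ∧
          ∀ N, ∃ k, N ≤ k ∧ FreeTail.IsSatellite j b k ∧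
            (ordZero (c k).F).toNat + (ordZero (c (k + 1)).F).toNat + 3 ≤ 3 * p) ∧
      (¬ ∃ (c : ℕ → State K) (d : ℕ) (j : ℕ → Fin 4) (b : ℕ → Fin 4 → K), 2 ≤ d ∧ d < p ∧
          (∀ e' ∈ (c 0).F.support, (c 0).r ≤ e') ∧ FreeTail.IsWitnessedChain p c j b ∧
          (∀ k, IsIsolated p (c k).F ∧ Step0 p (c k) (c (k + 1)) ∧ ordZero (c k).F ≠ p ∧
            (c k).shade = (d : ℕ∞) ∧ Module.finrank K (resVertex (c k)) = 2) ∧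
          ∀ N, ∃ k, N ≤ k ∧ ∃ i, i ≠ j k ∧ b k i ≠ 0 ∧ 1 ≤ (c k).r i) := by
  rw [noAboveFloorTrap_iff_lightSlices]
  refine forall_congr' fun K => forall_congr' fun _ => forall_congr' fun _ => forall_congr' fun _ => ?_
  rw [sliceC_iff_noLossyTrap]

/-- **K2(5) ⟺ no `(6, 6)`-satellite-recurrent power-cone trap ∧ no lossy binary-cone trap**, unconditionally in the
kernel. [OURS] [cite: CossartJannsenSaito2020, Thm. 3.14] -/
theorem noAboveFloorTrap_five_iff_lightSliceB_and_lossySliceC :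
    NoAboveFloorTrap 5 5 ↔ ∀ (K : Type) [Field K] [CharP K 5] [DecidableEq K],
      (¬ ∃ (c : ℕ → State K) (d : ℕ) (j : ℕ → Fin 4) (b : ℕ → Fin 4 → K), 2 ≤ d ∧ d ≤ 4 ∧
          (∀ e' ∈ (c 0).F.support, (c 0).r ≤ e') ∧ FreeTail.IsWitnessedChain 5 c j b ∧
          (∀ k, IsIsolated 5 (c k).F ∧ Step0 5 (c k) (c (k + 1)) ∧ ordZero (c k).F ≠ (5 : ℕ) ∧
            (c k).shade = (d : ℕ∞) ∧ Module.finrank K (resVertex (c k)) = 3) ∧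
          ∀ N, ∃ k, N ≤ k ∧ FreeTail.IsSatellite j b k ∧
            ordZero (c k).F = (6 : ℕ) ∧ ordZero (c (k + 1)).F = (6 : ℕ)) ∧
      (¬ ∃ (c : ℕ → State K) (d : ℕ) (j : ℕ → Fin 4) (b : ℕ → Fin 4 → K), 2 ≤ d ∧ d ≤ 4 ∧
          (∀ e' ∈ (c 0).F.support, (c 0).r ≤ e') ∧ FreeTail.IsWitnessedChain 5 c j b ∧
          (∀ k, IsIsolated 5 (c k).F ∧ Step0 5 (c k) (c (k + 1)) ∧ ordZero (c k).F ≠ (5 : ℕ) ∧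
            (c k).shade = (d : ℕ∞) ∧ Module.finrank K (resVertex (c k)) = 2) ∧
          ∀ N, ∃ k, N ≤ k ∧ ∃ i, i ≠ j k ∧ b k i ≠ 0 ∧ 1 ≤ (c k).r i) := by
  haveI : Fact (Nat.Prime 5) := ⟨by norm_num⟩
  rw [noAboveFloorTrap_five_iff_lightSlices]
  refine forall_congr' fun K => forall_congr' fun _ => forall_congr' fun _ => forall_congr' fun _ => ?_
  have h := sliceC_iff_noLossyTrap 5 K
  have e1 : (¬ ∃ (c : ℕ → State K) (d : ℕ), 2 ≤ d ∧ d ≤ 4 ∧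
        (∀ e' ∈ (c 0).F.support, (c 0).r ≤ e') ∧
        ∀ k, IsIsolated 5 (c k).F ∧ Step0 5 (c k) (c (k + 1)) ∧ ordZero (c k).F ≠ (5 : ℕ) ∧
          (c k).shade = (d : ℕ∞) ∧ Module.finrank K (resVertex (c k)) = 2) ↔
      (¬ ∃ (c : ℕ → State K) (d : ℕ) (j : ℕ → Fin 4) (b : ℕ → Fin 4 → K), 2 ≤ d ∧ d ≤ 4 ∧
        (∀ e' ∈ (c 0).F.support, (c 0).r ≤ e') ∧ FreeTail.IsWitnessedChain 5 c j b ∧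
        (∀ k, IsIsolated 5 (c k).F ∧ Step0 5 (c k) (c (k + 1)) ∧ ordZero (c k).F ≠ (5 : ℕ) ∧
          (c k).shade = (d : ℕ∞) ∧ Module.finrank K (resVertex (c k)) = 2) ∧
        ∀ N, ∃ k, N ≤ k ∧ ∃ i, i ≠ j k ∧ b k i ≠ 0 ∧ 1 ≤ (c k).r i) := by
    have e4 : ∀ d : ℕ, d ≤ 4 ↔ d < 5 := fun d => by omega
    simp only [e4]
    exact h
  rw [e1]

end ResCone

end Summit.ResolutionOfSingularities.ResolutionOfSingularities.Theorems.PIDim4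

end
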